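import Mathlib.NumberTheory.Real.Irrational
import Mathlib.NumberTheory.NumberField.Basic
import Mathlib.FieldTheory.IntermediateField.Adjoin.Basic
import Mathlib.Analysis.SpecialFunctions.Complex.Log
import Literature.NumberTheory.Transcendental.TwoLogarithmsZeroLemma
import HarnessLib

/-!
# The two logarithms `log ε₂₁`, `log ε₃₃` of Baker's class number one argument: field data

Topic `NumberTheory/QuadraticFields`, namespace `Literature.NumberTheory.QuadraticFields.BakerTwoLog`.
Everything here is PROVED (plus explicit definitions).

Baker 1975, Ch. 5 §4 / Baker–Wüstholz 2007, §3.1 reduce the class number one problem to a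
lower bound for `|b₁ log ε₂₁ - b₂ log ε₃₃|`, `ε₂₁ = (5 + √21)/2`, `ε₃₃ = 23 + 4√33`
("since `α₁ = ε₂₁` and `α₂ = ε₃₃` are multiplicatively independent"). This file supplies the
data consumed by the tree's explicit two-logarithm bound (`TwoLog.lower_bound_core`,
`TwoLogarithmsLowerBound.lean`):

* `e21`, `e33` and their quadratic equations, `1 < e21 < e33`;
* **multiplicative independence** (`zpow_eq_zpow_iff`): `ε₂₁^a = ε₃₃^c` (`a, c ∈ ℤ`) only for
  `a = c = 0` — via `ε₂₁ⁿ = u + v√21`, `ε₃₃ᵐ = u' + v'√33` (`v, v' > 0`) and `√693 ∉ ℚ`; hence the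
  injectivity of `(r, s) ↦ r log ε₂₁ + s log ε₃₃` and of `(r, s) ↦ e^{r log ε₂₁ + s log ε₃₃}`
  (`injOn_cexp`);
* distinct abscissae `r b₂ + s b₁` on a grid for coprime `b₁, b₂` (`injOn_xc_of_coprime_left/right`);
* the number field `F = ℚ(ε₂₁) ⊔ ℚ(ε₃₃) ⊂ ℂ` (`fld`), of degree `≤ 4` (`finrank_fld_le`), the units
  as algebraic integers `a21, a33 ∈ 𝓞 F`, and the conjugate bound `47` (`norm_conj_a21_le`,
  `norm_conj_a33_le`: a conjugate `z` satisfies `z² = 5z - 1`, resp. `z² = 46z - 1`).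

## References

* A. Baker, *Transcendental Number Theory* (1975), Ch. 5 §4. [Baker1975]
* A. Baker, G. Wüstholz, *Logarithmic Forms and Diophantine Geometry* (2007), §3.1 p. 37.
  [BakerWustholz2007]
-/

noncomputable section

open Complex IntermediateField Polynomial
open Literature.NumberTheory.Transcendental Literature.NumberTheory.Transcendental.TwoLog

namespace Literature.NumberTheory.QuadraticFields.BakerTwoLog

/-! ### The two units as real numbers -/

/-- `ε₂₁ = (5 + √21)/2`, the fundamental unit of `ℚ(√21)`. [cite: BakerWustholz2007, §3.1 p. 37] -/
def e21 : ℝ := (5 + Real.sqrt 21) / 2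

/-- `ε₃₃ = 23 + 4√33`, the fundamental unit of `ℚ(√33)`. [cite: BakerWustholz2007, §3.1 p. 37] -/
def e33 : ℝ := 23 + 4 * Real.sqrt 33

/-- `(√21)² = 21`. [folklore] -/
theorem sqrt21_sq : Real.sqrt 21 ^ 2 = 21 := Real.sq_sqrt (by norm_num)

/-- `(√33)² = 33`. [folklore] -/
theorem sqrt33_sq : Real.sqrt 33 ^ 2 = 33 := Real.sq_sqrt (by norm_num)

/-- `4 < √21 < 5`. [folklore] -/
theorem sqrt21_bounds : 4 < Real.sqrt 21 ∧ Real.sqrt 21 < 5 := by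
  have := sqrt21_sq
  constructor <;> nlinarith [Real.sqrt_nonneg 21]

/-- `5 < √33 < 6`. [folklore] -/
theorem sqrt33_bounds : 5 < Real.sqrt 33 ∧ Real.sqrt 33 < 6 := by
  have := sqrt33_sq
  constructor <;> nlinarith [Real.sqrt_nonneg 33]

/-- `ε₂₁² = 5ε₂₁ - 1`. [folklore] -/
theorem e21_sq : e21 ^ 2 = 5 * e21 - 1 := by
  unfold e21; have := sqrt21_sq; nlinarith

/-- `ε₃₃² = 46ε₃₃ - 1`. [folklore] -/
theorem e33_sq : e33 ^ 2 = 46 * e33 - 1 := by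
  unfold e33; have := sqrt33_sq; nlinarith

/-- `1 < ε₂₁`. [folklore] -/
theorem one_lt_e21 : 1 < e21 := by
  unfold e21; have := sqrt21_bounds; linarith

/-- `1 < ε₃₃`. [folklore] -/
theorem one_lt_e33 : 1 < e33 := by
  unfold e33; have := sqrt33_bounds; linarith

/-- `ε₂₁ < 5`. [folklore] -/
theorem e21_lt_five : e21 < 5 := by
  unfold e21; have := sqrt21_bounds; linarith

/-- `ε₃₃ < 47`. [folklore] -/
theorem e33_lt : e33 < 47 := by
  unfold e33; have := sqrt33_bounds; linarith

/-! ### Multiplicative independence -/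

/-- `ε₂₁ⁿ = u + v√21` with rationals `u > 0`, `v ≥ 0`, and `v > 0` for `n ≥ 1`. [folklore] -/
theorem e21_pow_eq (n : ℕ) : ∃ u v : ℚ, 0 < u ∧ 0 ≤ v ∧ (1 ≤ n → 0 < v) ∧
    e21 ^ n = u + v * Real.sqrt 21 := by
  induction n with
  | zero => exact ⟨1, 0, by norm_num, le_rfl, fun h => absurd h (by norm_num), by simp⟩
  | succ n ih =>
    obtain ⟨u, v, hu, hv, _, he⟩ := ih
    refine ⟨(5 * u + 21 * v) / 2, (u + 5 * v) / 2, by positivity, by positivity,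
      fun _ => by positivity, ?_⟩
    rw [pow_succ, he]
    unfold e21
    push_cast
    linear_combination ((v : ℝ) / 2) * sqrt21_sq

/-- `ε₃₃ⁿ = u + v√33` with rationals `u > 0`, `v ≥ 0`, and `v > 0` for `n ≥ 1`. [folklore] -/
theorem e33_pow_eq (n : ℕ) : ∃ u v : ℚ, 0 < u ∧ 0 ≤ v ∧ (1 ≤ n → 0 < v) ∧
    e33 ^ n = u + v * Real.sqrt 33 := by
  induction n with
  | zero => exact ⟨1, 0, by norm_num, le_rfl, fun h => absurd h (by norm_num), by simp⟩
  | succ n ih =>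
    obtain ⟨u, v, hu, hv, _, he⟩ := ih
    refine ⟨23 * u + 132 * v, 4 * u + 23 * v, by positivity, by positivity,
      fun _ => by positivity, ?_⟩
    rw [pow_succ, he]
    unfold e33
    push_cast
    linear_combination (4 * (v : ℝ)) * sqrt33_sq

/-- `√693 = √21 · √33` is irrational (`693 = 9·7·11`). [folklore] -/
theorem irrational_sqrt21_mul_sqrt33 : Irrational (Real.sqrt 21 * Real.sqrt 33) := by
  rw [← Real.sqrt_mul (by norm_num), show (21 : ℝ) * 33 = (693 : ℕ) by norm_num]
  refine irrational_sqrt_natCast_iff.mpr ?_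
  rintro ⟨r, hr⟩
  rcases le_or_gt r 26 with h | h <;> nlinarith

/-- **`ε₂₁ᵃ ≠ ε₃₃ᶜ` for positive exponents.** [cite: BakerWustholz2007, §3.1 p. 37] -/
theorem pow_ne_pow {a c : ℕ} (ha : 1 ≤ a) (hc : 1 ≤ c) : e21 ^ a ≠ e33 ^ c := by
  intro h
  obtain ⟨u, v, _, _, hv, hu⟩ := e21_pow_eq a
  obtain ⟨u', v', _, _, hv', hu'⟩ := e33_pow_eq c
  have hv0 := hv ha
  have hv0' := hv' hc
  rw [hu, hu'] at h
  -- `v√21 - v'√33 = u' - u`, square it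
  have hq : (v : ℝ) * Real.sqrt 21 - v' * Real.sqrt 33 = u' - u := by linarith
  have hsq := congrArg (fun x : ℝ => x ^ 2) hq
  have h21 := sqrt21_sq
  have h33 := sqrt33_sq
  have hprod : Real.sqrt 21 * Real.sqrt 33 =
      ((21 * v ^ 2 + 33 * v' ^ 2 - (u' - u) ^ 2) / (2 * v * v') : ℚ) := by
    have hvv : (2 * v * v' : ℝ) ≠ 0 := by positivity
    push_cast
    field_simp
    nlinarith [hsq]
  exact irrational_sqrt21_mul_sqrt33 ⟨_, hprod.symm⟩

/-- **Multiplicative independence of `ε₂₁` and `ε₃₃`**: `ε₂₁ᵃ = ε₃₃ᶜ` with `a, c ∈ ℤ` forces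
`a = c = 0`. [cite: BakerWustholz2007, §3.1 p. 37] -/
theorem zpow_eq_zpow_iff {a c : ℤ} : e21 ^ a = e33 ^ c ↔ a = 0 ∧ c = 0 := by
  have h21 := one_lt_e21
  have h33 := one_lt_e33
  have key : ∀ a c : ℤ, 0 < a → e21 ^ a = e33 ^ c → False := by
    intro a c ha h
    have hc : 0 < c := by
      by_contra hc
      push Not at hc
      have h1 : (1 : ℝ) < e21 ^ a := one_lt_zpow₀ h21 ha
      have h2 : e33 ^ c ≤ 1 := zpow_le_one_of_nonpos₀ h33.le hc
      linarith
    lift a to ℕ using ha.le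
    lift c to ℕ using hc.le
    rw [zpow_natCast, zpow_natCast] at h
    exact pow_ne_pow (by exact_mod_cast ha) (by exact_mod_cast hc) h
  constructor
  · intro h
    rcases lt_trichotomy a 0 with ha | ha | ha
    · exfalso
      refine key (-a) (-c) (by omega) ?_
      rw [zpow_neg, zpow_neg, h]
    · subst ha
      refine ⟨rfl, ?_⟩
      rw [zpow_zero] at h
      by_contra hc
      rcases lt_or_gt_of_ne hc with hc | hc
      · have : e33 ^ c < 1 := zpow_lt_one_of_neg₀ h33 hc
        linarith
      · have : 1 < e33 ^ c := one_lt_zpow₀ h33 hc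
        linarith
    · exact (key a c ha h).elim
  · rintro ⟨rfl, rfl⟩; simp

/-- **Injectivity of `(r, s) ↦ r log ε₂₁ + s log ε₃₃`** on `ℕ²`. [cite: BakerWustholz2007, §3.1 p. 37] -/
theorem add_log_injective :
    Function.Injective (fun p : ℕ × ℕ => p.1 * Real.log e21 + p.2 * Real.log e33) := by
  intro p q h
  simp only at h
  have h21 := one_lt_e21
  have h33 := one_lt_e33
  have hexp : e21 ^ p.1 * e33 ^ p.2 = e21 ^ q.1 * e33 ^ q.2 := by
    have := congrArg Real.exp h
    rwa [Real.exp_add, Real.exp_add, Real.exp_nat_mul, Real.exp_nat_mul, Real.exp_nat_mul,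
      Real.exp_nat_mul, Real.exp_log (by linarith), Real.exp_log (by linarith)] at this
  -- `e21^(p.1 - q.1) = e33^(q.2 - p.2)` as integer powers
  have hz : e21 ^ ((p.1 : ℤ) - q.1) = e33 ^ ((q.2 : ℤ) - p.2) := by
    rw [zpow_sub₀ (by linarith), zpow_sub₀ (by linarith), zpow_natCast, zpow_natCast, zpow_natCast,
      zpow_natCast, div_eq_div_iff (by positivity) (by positivity)]
    linear_combination hexp
  obtain ⟨h1, h2⟩ := zpow_eq_zpow_iff.mp hz
  exact Prod.ext (by omega) (by omega)

/-- The two logarithms as complex numbers: `l₁ = log ε₂₁`, `l₂ = log ε₃₃`. [folklore] -/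
theorem injOn_cexp (T : Set (ℕ × ℕ)) :
    Set.InjOn (fun p : ℕ × ℕ => cexp (p.1 * (Real.log e21 : ℂ) + p.2 * (Real.log e33 : ℂ))) T := by
  intro p _ q _ h
  apply add_log_injective
  have h' : cexp ((p.1 * Real.log e21 + p.2 * Real.log e33 : ℝ) : ℂ) =
      cexp ((q.1 * Real.log e21 + q.2 * Real.log e33 : ℝ) : ℂ) := by
    push_cast at h ⊢; exact h
  rw [← Complex.ofReal_exp, ← Complex.ofReal_exp, Complex.ofReal_inj] at h'
  exact Real.exp_injective h'

/-! ### Distinct abscissae for coprime coefficients -/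

/-- For coprime `b₁, b₂` with `R ≤ b₁`, the abscissae `r b₂ + s b₁` (`r < R`) are pairwise
distinct. [folklore] -/
theorem injOn_xc_of_coprime_left {b₁ b₂ R S : ℕ} (hcop : Nat.Coprime b₁ b₂) (hR : R ≤ b₁) :
    Set.InjOn (fun p : ℕ × ℕ => xc b₁ b₂ p.1 p.2) ↑(grid R S) := by
  intro p hp q hq h
  simp only [grid, Finset.coe_product, Finset.coe_range, Set.mem_prod, Set.mem_Iio] at hp hq
  simp only [xc] at h
  -- `b₁ ∣ (p.1 - q.1) b₂`, hence `b₁ ∣ p.1 - q.1`, hence `p.1 = q.1`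
  have h1 : (p.1 : ℤ) = q.1 := by
    have hz : (p.1 : ℤ) * b₂ + p.2 * b₁ = q.1 * b₂ + q.2 * b₁ := by exact_mod_cast h
    have hdvd : (b₁ : ℤ) ∣ ((p.1 : ℤ) - q.1) * b₂ := ⟨(q.2 : ℤ) - p.2, by linarith⟩
    have hdvd' : (b₁ : ℤ) ∣ (p.1 : ℤ) - q.1 :=
      (Int.isCoprime_iff_gcd_eq_one.mpr (by simpa [Int.gcd_natCast_natCast] using hcop)).dvd_of_dvd_mul_right hdvd
    have habs : |(p.1 : ℤ) - q.1| < b₁ := by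
      rw [abs_lt]; constructor <;> omega
    exact sub_eq_zero.mp (Int.eq_zero_of_abs_lt_dvd hdvd' habs)
  have h1' : p.1 = q.1 := by exact_mod_cast h1
  have hb₁ : 0 < b₁ := by omega
  have h2 : p.2 = q.2 := by
    rw [h1'] at h
    exact Nat.eq_of_mul_eq_mul_right hb₁ (by omega)
  exact Prod.ext h1' h2

/-- For coprime `b₁, b₂` with `S ≤ b₂`, the abscissae `r b₂ + s b₁` (`s < S`) are pairwise
distinct. [folklore] -/
theorem injOn_xc_of_coprime_right {b₁ b₂ R S : ℕ} (hcop : Nat.Coprime b₁ b₂) (hS : S ≤ b₂) :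
    Set.InjOn (fun p : ℕ × ℕ => xc b₁ b₂ p.1 p.2) ↑(grid R S) := by
  intro p hp q hq h
  simp only [grid, Finset.coe_product, Finset.coe_range, Set.mem_prod, Set.mem_Iio] at hp hq
  simp only [xc] at h
  have h1 : (p.2 : ℤ) = q.2 := by
    have hz : (p.1 : ℤ) * b₂ + p.2 * b₁ = q.1 * b₂ + q.2 * b₁ := by exact_mod_cast h
    have hdvd : (b₂ : ℤ) ∣ ((p.2 : ℤ) - q.2) * b₁ := ⟨(q.1 : ℤ) - p.1, by linarith⟩
    have hdvd' : (b₂ : ℤ) ∣ (p.2 : ℤ) - q.2 :=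
      (Int.isCoprime_iff_gcd_eq_one.mpr (by simpa [Int.gcd_natCast_natCast, Nat.coprime_comm] using hcop)).dvd_of_dvd_mul_right hdvd
    have habs : |(p.2 : ℤ) - q.2| < b₂ := by
      rw [abs_lt]; constructor <;> omega
    exact sub_eq_zero.mp (Int.eq_zero_of_abs_lt_dvd hdvd' habs)
  have h1' : p.2 = q.2 := by exact_mod_cast h1
  have hb₂ : 0 < b₂ := by omega
  have h2 : p.1 = q.1 := by
    rw [h1'] at h
    exact Nat.eq_of_mul_eq_mul_right hb₂ (by omega)
  exact Prod.ext h2 h1'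

/-! ### The number field `ℚ(ε₂₁, ε₃₃) ⊂ ℂ` -/

/-- `F = ℚ(ε₂₁) ⊔ ℚ(ε₃₃) ⊂ ℂ`. [folklore] -/
def fld : IntermediateField ℚ ℂ := ℚ⟮((e21 : ℝ) : ℂ)⟯ ⊔ ℚ⟮((e33 : ℝ) : ℂ)⟯

/-- `ε₂₁ ∈ ℂ` is a root of the monic `X² - 5X + 1`. [folklore] -/
theorem aeval_e21 : aeval ((e21 : ℝ) : ℂ) (X ^ 2 - 5 * X + 1 : ℤ[X]) = 0 := by
  have h := e21_sq
  simp only [aeval_add, aeval_sub, aeval_mul, aeval_X_pow, aeval_X, map_ofNat, aeval_one]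
  have : ((e21 : ℝ) : ℂ) ^ 2 = 5 * ((e21 : ℝ) : ℂ) - 1 := by exact_mod_cast h
  rw [this]; ring

/-- `ε₃₃ ∈ ℂ` is a root of the monic `X² - 46X + 1`. [folklore] -/
theorem aeval_e33 : aeval ((e33 : ℝ) : ℂ) (X ^ 2 - 46 * X + 1 : ℤ[X]) = 0 := by
  have h := e33_sq
  simp only [aeval_add, aeval_sub, aeval_mul, aeval_X_pow, aeval_X, map_ofNat, aeval_one]
  have : ((e33 : ℝ) : ℂ) ^ 2 = 46 * ((e33 : ℝ) : ℂ) - 1 := by exact_mod_cast h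
  rw [this]; ring

/-- `ε₂₁` is a root of `X² - 5X + 1 ∈ ℚ[X]`. [folklore] -/
theorem aeval_e21_rat : aeval ((e21 : ℝ) : ℂ) (X ^ 2 - 5 * X + 1 : ℚ[X]) = 0 := by
  have h := e21_sq
  simp only [aeval_add, aeval_sub, aeval_mul, aeval_X_pow, aeval_X, map_ofNat, aeval_one]
  have : ((e21 : ℝ) : ℂ) ^ 2 = 5 * ((e21 : ℝ) : ℂ) - 1 := by exact_mod_cast h
  rw [this]; ring

/-- `ε₃₃` is a root of `X² - 46X + 1 ∈ ℚ[X]`. [folklore] -/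
theorem aeval_e33_rat : aeval ((e33 : ℝ) : ℂ) (X ^ 2 - 46 * X + 1 : ℚ[X]) = 0 := by
  have h := e33_sq
  simp only [aeval_add, aeval_sub, aeval_mul, aeval_X_pow, aeval_X, map_ofNat, aeval_one]
  have : ((e33 : ℝ) : ℂ) ^ 2 = 46 * ((e33 : ℝ) : ℂ) - 1 := by exact_mod_cast h
  rw [this]; ring

/-- The monic quadratics. [folklore] -/
theorem monic21 : (X ^ 2 - 5 * X + 1 : ℤ[X]).Monic := by
  monicity!

/-- The monic quadratics. [folklore] -/
theorem monic33 : (X ^ 2 - 46 * X + 1 : ℤ[X]).Monic := by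
  monicity!

/-- `ε₂₁` is an algebraic integer. [folklore] -/
theorem isIntegral_e21 : IsIntegral ℤ ((e21 : ℝ) : ℂ) := ⟨_, monic21, by
  rw [← aeval_def]; exact aeval_e21⟩

/-- `ε₃₃` is an algebraic integer. [folklore] -/
theorem isIntegral_e33 : IsIntegral ℤ ((e33 : ℝ) : ℂ) := ⟨_, monic33, by
  rw [← aeval_def]; exact aeval_e33⟩

/-- `F/ℚ` is finite-dimensional. [folklore] -/
instance finiteDimensional_fld : FiniteDimensional ℚ fld := by
  unfold fld
  haveI : FiniteDimensional ℚ ℚ⟮((e21 : ℝ) : ℂ)⟯ :=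
    adjoin.finiteDimensional (isIntegral_e21.tower_top)
  haveI : FiniteDimensional ℚ ℚ⟮((e33 : ℝ) : ℂ)⟯ :=
    adjoin.finiteDimensional (isIntegral_e33.tower_top)
  infer_instance

/-- `F` is a number field. [folklore] -/
instance numberField_fld : NumberField fld :=
  { to_charZero := charZero_of_injective_algebraMap (algebraMap ℚ fld).injective
    to_finiteDimensional := finiteDimensional_fld }

/-- **`[F : ℚ] ≤ 4`.** [folklore] -/
theorem finrank_fld_le : Module.finrank ℚ fld ≤ 4 := by
  have h1 : Module.finrank ℚ ℚ⟮((e21 : ℝ) : ℂ)⟯ ≤ 2 := by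
    rw [adjoin.finrank isIntegral_e21.tower_top]
    have := minpoly.min ℚ ((e21 : ℝ) : ℂ) (p := (X ^ 2 - 5 * X + 1 : ℚ[X]))
      (by monicity!) aeval_e21_rat
    have hdeg : (X ^ 2 - 5 * X + 1 : ℚ[X]).natDegree = 2 := by compute_degree!
    exact (natDegree_le_natDegree this).trans hdeg.le
  have h2 : Module.finrank ℚ ℚ⟮((e33 : ℝ) : ℂ)⟯ ≤ 2 := by
    rw [adjoin.finrank isIntegral_e33.tower_top]
    have := minpoly.min ℚ ((e33 : ℝ) : ℂ) (p := (X ^ 2 - 46 * X + 1 : ℚ[X]))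
      (by monicity!) aeval_e33_rat
    have hdeg : (X ^ 2 - 46 * X + 1 : ℚ[X]).natDegree = 2 := by compute_degree!
    exact (natDegree_le_natDegree this).trans hdeg.le
  calc Module.finrank ℚ fld ≤ Module.finrank ℚ ℚ⟮((e21 : ℝ) : ℂ)⟯ * Module.finrank ℚ ℚ⟮((e33 : ℝ) : ℂ)⟯ :=
        finrank_sup_le _ _
    _ ≤ 2 * 2 := Nat.mul_le_mul h1 h2

/-- `ε₂₁ ∈ F`. [folklore] -/
theorem e21_mem : ((e21 : ℝ) : ℂ) ∈ fld :=
  (le_sup_left : ℚ⟮((e21 : ℝ) : ℂ)⟯ ≤ fld) (mem_adjoin_simple_self ℚ _)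

/-- `ε₃₃ ∈ F`. [folklore] -/
theorem e33_mem : ((e33 : ℝ) : ℂ) ∈ fld :=
  (le_sup_right : ℚ⟮((e33 : ℝ) : ℂ)⟯ ≤ fld) (mem_adjoin_simple_self ℚ _)

/-- `ε₂₁` as an algebraic integer of `F`. [folklore] -/
def a21 : NumberField.RingOfIntegers fld :=
  ⟨⟨((e21 : ℝ) : ℂ), e21_mem⟩, (isIntegral_algebraMap_iff (A := fld) (B := ℂ)
    (algebraMap fld ℂ).injective).mp isIntegral_e21⟩

/-- `ε₃₃` as an algebraic integer of `F`. [folklore] -/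
def a33 : NumberField.RingOfIntegers fld :=
  ⟨⟨((e33 : ℝ) : ℂ), e33_mem⟩, (isIntegral_algebraMap_iff (A := fld) (B := ℂ)
    (algebraMap fld ℂ).injective).mp isIntegral_e33⟩

/-- `φ(a21) = ε₂₁` for the inclusion `φ : F ⊂ ℂ`. [folklore] -/
@[simp] theorem algebraMap_a21 : algebraMap fld ℂ (a21 : fld) = ((e21 : ℝ) : ℂ) := rfl

/-- `φ(a33) = ε₃₃`. [folklore] -/
@[simp] theorem algebraMap_a33 : algebraMap fld ℂ (a33 : fld) = ((e33 : ℝ) : ℂ) := rfl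

/-- `e^{log ε₂₁} = φ(a21)`. [folklore] -/
theorem cexp_log_e21 : cexp (Real.log e21 : ℂ) = algebraMap fld ℂ (a21 : fld) := by
  rw [algebraMap_a21, ← Complex.ofReal_exp, Real.exp_log (by linarith [one_lt_e21])]

/-- `e^{log ε₃₃} = φ(a33)`. [folklore] -/
theorem cexp_log_e33 : cexp (Real.log e33 : ℂ) = algebraMap fld ℂ (a33 : fld) := by
  rw [algebraMap_a33, ← Complex.ofReal_exp, Real.exp_log (by linarith [one_lt_e33])]

/-- A complex root of `z² = cz - 1` with `c ≥ 2` has `|z| < c + 1`. [folklore] -/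
theorem norm_lt_of_sq_eq {z : ℂ} {c : ℝ} (hc : 2 ≤ c) (h : z ^ 2 = c * z - 1) : ‖z‖ < c + 1 := by
  by_contra hz
  push Not at hz
  have h1 : ‖z‖ ^ 2 = ‖(c : ℂ) * z - 1‖ := by rw [← norm_pow, h]
  have h2 : ‖(c : ℂ) * z - 1‖ ≤ c * ‖z‖ + 1 := by
    calc ‖(c : ℂ) * z - 1‖ ≤ ‖(c : ℂ) * z‖ + ‖(1 : ℂ)‖ := norm_sub_le _ _
      _ = c * ‖z‖ + 1 := by rw [norm_mul, Complex.norm_real, Real.norm_eq_abs, abs_of_nonneg (by linarith), norm_one]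
  nlinarith

/-- **Conjugate bound for `ε₂₁`**: every conjugate has modulus `≤ 47`. [folklore] -/
theorem norm_conj_a21_le (σ : fld →+* ℂ) : ‖σ (a21 : fld)‖ ≤ 47 := by
  have h : (a21 : fld) ^ 2 = 5 * (a21 : fld) - 1 := by
    apply (algebraMap fld ℂ).injective
    rw [map_pow, map_sub, map_mul, map_one, algebraMap_a21, map_ofNat]
    exact_mod_cast e21_sq
  have h' : (σ (a21 : fld)) ^ 2 = (5 : ℝ) * σ (a21 : fld) - 1 := by
    have := congrArg σ h
    rw [map_pow, map_sub, map_mul, map_one, map_ofNat] at this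
    push_cast; exact this
  have := norm_lt_of_sq_eq (by norm_num) h'
  linarith

/-- **Conjugate bound for `ε₃₃`**: every conjugate has modulus `≤ 47`. [folklore] -/
theorem norm_conj_a33_le (σ : fld →+* ℂ) : ‖σ (a33 : fld)‖ ≤ 47 := by
  have h : (a33 : fld) ^ 2 = 46 * (a33 : fld) - 1 := by
    apply (algebraMap fld ℂ).injective
    rw [map_pow, map_sub, map_mul, map_one, algebraMap_a33, map_ofNat]
    exact_mod_cast e33_sq
  have h' : (σ (a33 : fld)) ^ 2 = (46 : ℝ) * σ (a33 : fld) - 1 := by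
    have := congrArg σ h
    rw [map_pow, map_sub, map_mul, map_one, map_ofNat] at this
    push_cast; exact this
  have := norm_lt_of_sq_eq (by norm_num) h'
  linarith

end Literature.NumberTheory.QuadraticFields.BakerTwoLog

end
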